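import Literature.NumberTheory.Rogawski1990.FinExplicitTransferFactorSplitPlace      -- ★ p835818 D-S2: `norm_eval_finCharpolyTwo_galInv`, `eval_finCharpolyTwo_apply`, `finExplicitDelta_eq_tau_mul_weyl_of_split`
import Literature.NumberTheory.Rogawski1990.ExplicitFactorRationalLocalisation      -- ★ `archWeylRatio_rationalArch`, `archCharpolyTwo_rationalArch`, `archGammaTwo_rationalArch`
import Literature.NumberTheory.Rogawski1990.FinExplicitTransferFactorColumnUnit        -- ★ F2A p835149: `finKappaAt_eq_ite_finColumnFormValue` (ED. 2 §4)
import HarnessLib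

/-!
# Rogawski's explicit factor at the SCALAR PARTNER `γ_H = (e·1₂, u)` — the `H`-side of print's singular `γ₀ = diag(e, e, u) ∈ M`: `χ_g(u) = (u − e)²`,
# `τ_v = μ_v(u)·μ_v(−(u−e)²e⁻²)⁻¹`, `D_{G∕H,v} = Π_{w∣v} ‖u − e‖_w`, and at a split `v`: `D_{G∕H,v} = ‖u − e‖_w² ∕ (‖e‖_w ‖u‖_w)` (Rogawski (1990) §4.9, Prop. 8.2.1 (a))

Topic `NumberTheory/Rogawski1990`; namespace `Literature.NumberTheory.Rogawski1990`.  THEOREMS ONLY (no definition, no named fact, no instance, no notation,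
no `sorry`; net debt 0).  Cell `pub/hodgecm-mathlib`, F0∕P3a, topic T6 (#88 side; road letter «D-S2s»: the VALUES of the explicit factor at the point where every
constant of the (κ-loc)∕(κ-arch)∕(κ-sign) conjuncts of `S1′` is read — F0P3a-p04 (g11) 22:03:09Z: «`c_v` comes out as `(τ_v(γ_H)·D_v(γ_H))⁻¹ × C` at the
singular pair … `D_v = ‖e₁−e₂‖²∕‖e₁e₂‖`»).  The tree's idiom for a scalar first block is the HYPOTHESIS `(γ_H.1 : matrix) = e • 1` (★
`transfersTo_mk_of_fst_eq_smul_one`, ★ `exists_anchoredSJH_eq_mul_of_fst_eq_smul_one`).  Mathlib-only footing; count-neutral for the books.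

THE MATHEMATICS (`v` finite, `E_v = Π_{w∣v} L_w`, `γ_H = (g, u) ∈ H_v` with `g = e·1₂`, `e ∈ E_v`).  `χ_g = (X − e)²`, so `χ_g(u) = (u − e)²`, `det g = e²`,
`(γ₂γ₁⁻¹ − 1)(1 − γ₂γ₃⁻¹) = −χ_g(u)∕det g = −(u − e)²∕e²` (★ `finTauArg`), `τ_v = μ_v(u)·μ_v(−(u−e)²∕e²)⁻¹` (★ `finTau`); `(G,H)`-regularity of the pair
`χ_g(u) ∈ E_vˣ` is `u − e ∈ E_vˣ` («`e_w ≠ u_w` at every `w ∣ v`»); `D_{G∕H,v} = (Π_w ‖χ_g(u)_w‖)^{1∕2} = Π_w ‖(u − e)_w‖` (★ `finWeylRatio`); at a SPLIT `v`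
(★ D-S2 `norm_eval_finCharpolyTwo_galInv`: `‖χ_{w̄}‖ = ‖χ_w‖·‖det g_w‖⁻¹·‖u_w‖⁻²` with `det g_w = e_w²`): `‖(u−e)_{w̄}‖ = ‖(u−e)_w‖ ∕ (‖e_w‖ ‖u_w‖)` and
`D_{G∕H,v} = ‖(u − e)_w‖² ∕ (‖e_w‖·‖u_w‖)` — print's `|D_{G∕H}(γ₀)|` at `γ₀ = diag(e, e, u)`.  For a RATIONAL `γ_H = (e₁·1₂, e₂) ∈ H(L⁺)`: `χ_g(u) = (e₂ − e₁)²` in `L`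
(so the `(G,H)`-regularity guard `hχ : χ_g(u) ≠ 0` of ★ (P-α)…(P-γ), F4, G2 IS `e₁ ≠ e₂`) and `D_{G∕H,∞}(γ_H ⊗ 1) = Π_{w complex} ‖σ_w(e₂ − e₁)‖²`.

* §1 (local, any finite `v`) `finCharpolyTwo_of_fst_eq_smul_one`, **`eval_finCharpolyTwo_of_fst_eq_smul_one`** (`= (u − e)^2`), `det_fst_of_fst_eq_smul_one`,
  `isUnit_of_fst_eq_smul_one`, `coe_inv_fst_of_fst_eq_smul_one`, **`finTauArg_of_fst_eq_smul_one`**, **`finTau_of_fst_eq_smul_one`**, **`isUnit_eval_finCharpolyTwo_iff_of_fst_eq_smul_one`**, **`finWeylRatio_of_fst_eq_smul_one`**.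
* §2 (split `v`) **`norm_sub_galInv_of_fst_eq_smul_one`**, **`finWeylRatio_of_fst_eq_smul_one_of_split`** (`= ‖(u−e)_w‖² ∕ (‖e_w‖·‖u_w‖)`),
  `finExplicitDelta_of_fst_eq_smul_one_of_split`.
* §3 (rational) **`eval_charpoly_of_fst_eq_smul_one_rational`** (`χ_g(u) = (e₂ − e₁)²` in `L`), `eval_charpoly_ne_zero_iff_of_fst_eq_smul_one_rational`,
  **`archWeylRatio_rationalArch_of_fst_eq_smul_one`**.

EDITION LOG.  ED. 1 (★ p836099): §1–§3.  ED. 2 (this text, APPEND-ONLY; one import added): §4 — the projector and the sign at the scalar partner: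
`P_v((e·1₂,u), γ′) = (γ′ − e·1₃)²` (`χ_{e·1₂} = (X − e)²` evaluated at the matrix `γ′`), hence at a NON-SPLIT `v` the sign `κ_v` READS ON ANY NON-ZERO COLUMN of
`(γ′ − e)²` (★ F2A `finKappaAt_eq_ite_finColumnFormValue`): the (κ-loc) non-split letter's `κ_v(γ_H, γ′)` at print's singular partner, in terms of `γ′` alone.

* §4 **`finEigenlineProjector_of_fst_eq_smul_one`**, `finColumnFormValue_of_fst_eq_smul_one`, **`finKappaAt_of_fst_eq_smul_one_eq_ite`**.

HONEST LABEL: HC_CM is proved only modulo the printed citations (named inputs remaining 2) until rung 0 closes; this file proves none of them.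

## References
* [Rogawski1990] J. D. Rogawski, *Automorphic Representations of Unitary Groups in Three Variables*, Ann. of Math. Stud. 123 (1990): §4.9 p. 55 (`τ`, `D_{G∕H}`),
  Prop. 8.2.1 (a) p. 118 (the singular `γ₀ ∈ M`), Lemma 4.13.1 p. 70 (split descent), §14.5 Lemma 14.5.2 (b) p. 238.
-/

set_option autoImplicit false

noncomputable section

open NumberField IsDedekindDomain Matrix Polynomial
open scoped MatrixGroups

namespace Literature.NumberTheory.Rogawski1990

open Literature.NumberTheory.Automorphic
open Literature.NumberTheory.GaloisRepresentations

/-! ## §1 The explicit factor at a scalar first block (any finite `v`) -/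

section Local

variable (L : Type) [Field L] [NumberField L] [IsCMField L] (v : HeightOneSpectrum (𝓞 ↥(maximalRealSubfield L)))
  (a : (UnitaryGroup.cmDatum L 2 (Matrix.of fun i j : Fin 2 => if i.val + j.val + 1 = 2 then (1 : L) else 0)).Local v ×
      (UnitaryGroup.cmDatum L 1 (Matrix.of fun i j : Fin 1 => if i.val + j.val + 1 = 1 then (1 : L) else 0)).Local v)
  {e : UnitaryGroup.LocalRing L v} (h : (a.1.val.val : Matrix (Fin 2) (Fin 2) (UnitaryGroup.LocalRing L v)) = e • (1 : Matrix (Fin 2) (Fin 2) _))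

include h in
/-- **`χ_g = (X − e)²` for the scalar block `g = e·1₂`.** [cite: Rogawski1990, §4.9 p. 55] -/
theorem finCharpolyTwo_of_fst_eq_smul_one : finCharpolyTwo L v a = (X - C e) ^ 2 := by
  haveI : Nontrivial (UnitaryGroup.LocalRing L v) := inferInstance
  unfold finCharpolyTwo
  rw [h, Matrix.charpoly_fin_two]
  simp only [Matrix.trace_fin_two, Matrix.det_fin_two, Matrix.smul_apply, Matrix.one_apply_eq,
    Matrix.one_apply_ne (by decide : (0 : Fin 2) ≠ 1), Matrix.one_apply_ne (by decide : (1 : Fin 2) ≠ 0), smul_eq_mul, mul_one, mul_zero, sub_zero,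
    map_add, map_mul]
  ring

include h in
/-- **`χ_g(u) = (u − e)²` at the scalar partner.** [cite: Rogawski1990, §4.9 p. 55; Prop. 8.2.1 (a) p. 118] -/
theorem eval_finCharpolyTwo_of_fst_eq_smul_one :
    (finCharpolyTwo L v a).eval (finGammaTwo L v a) = (finGammaTwo L v a - e) ^ 2 := by
  rw [finCharpolyTwo_of_fst_eq_smul_one L v a h]
  simp only [eval_pow, eval_sub, eval_X, eval_C]

include h in
/-- `det g = e²` (print's `γ₁γ₃`). [cite: Rogawski1990, §4.9 p. 55] -/
theorem det_fst_of_fst_eq_smul_one : (a.1.val.val : Matrix (Fin 2) (Fin 2) (UnitaryGroup.LocalRing L v)).det = e ^ 2 := by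
  rw [h, Matrix.det_smul, Matrix.det_one, mul_one, Fintype.card_fin]

include h in
/-- `e` is a unit (`e² = det g`, `g ∈ U(Φ₂)(L⁺_v)` invertible). [cite: Rogawski1990, §4.9 p. 55] -/
theorem isUnit_of_fst_eq_smul_one : IsUnit e := by
  have hd : IsUnit (a.1.val.val : Matrix (Fin 2) (Fin 2) (UnitaryGroup.LocalRing L v)).det := Matrix.isUnits_det_units _
  rw [det_fst_of_fst_eq_smul_one L v a h] at hd
  exact (isUnit_pow_iff two_ne_zero).1 hd

include h in
/-- `e · e⁻¹ = 1` (componentwise inverse in `Π_w L_w`; `e` is a unit). [folklore] -/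
private theorem mul_inv_of_fst_eq_smul_one : e * e⁻¹ = 1 :=
  funext fun w => mul_inv_cancel₀ ((Pi.isUnit_iff.1 (isUnit_of_fst_eq_smul_one L v a h) w).ne_zero)

include h in
/-- `g⁻¹ = e⁻¹·1₂` for the scalar block (print's `γ₁⁻¹ = γ₃⁻¹ = e⁻¹`). [cite: Rogawski1990, §4.9 p. 55] -/
theorem coe_inv_fst_of_fst_eq_smul_one :
    ((a.1.val⁻¹).val : Matrix (Fin 2) (Fin 2) (UnitaryGroup.LocalRing L v)) = e⁻¹ • (1 : Matrix (Fin 2) (Fin 2) _) := by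
  have hmul : (a.1.val.val : Matrix (Fin 2) (Fin 2) (UnitaryGroup.LocalRing L v)) * (e⁻¹ • (1 : Matrix (Fin 2) (Fin 2) _)) = 1 := by
    rw [h, Matrix.smul_mul, Matrix.one_mul, smul_smul, mul_inv_of_fst_eq_smul_one L v a h, one_smul]
  calc ((a.1.val⁻¹).val : Matrix (Fin 2) (Fin 2) (UnitaryGroup.LocalRing L v))
      = (a.1.val⁻¹).val * ((a.1.val.val : Matrix (Fin 2) (Fin 2) (UnitaryGroup.LocalRing L v)) * (e⁻¹ • 1)) := by rw [hmul, Matrix.mul_one]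
    _ = e⁻¹ • (1 : Matrix (Fin 2) (Fin 2) _) := by rw [← Matrix.mul_assoc, ← Units.val_mul, inv_mul_cancel, Units.val_one, Matrix.one_mul]

include h in
/-- **`(γ₂γ₁⁻¹ − 1)(1 − γ₂γ₃⁻¹) = −(u − e)²·e⁻²`** (★ `finTauArg = −χ_g(u)·det g⁻¹`; `e⁻²` is the componentwise inverse in `Π_w L_w`). [cite: Rogawski1990, §4.9 p. 55] -/
theorem finTauArg_of_fst_eq_smul_one :
    finTauArg L v a = -((finGammaTwo L v a - e) ^ 2) * (e ^ 2)⁻¹ := by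
  unfold finTauArg
  rw [eval_finCharpolyTwo_of_fst_eq_smul_one L v a h, coe_inv_fst_of_fst_eq_smul_one L v a h, Matrix.det_smul, Matrix.det_one, mul_one,
    Fintype.card_fin, inv_pow]

include h in
/-- **`τ_v(γ_H) = μ_v(u) · μ_v(−(u − e)²·e⁻²)⁻¹`** at the scalar partner (unfolding ★ `finTau`). [cite: Rogawski1990, §4.9 p. 55] -/
theorem finTau_of_fst_eq_smul_one (μ : HeckeCharacter L) :
    finTau L v a μ = finHeckeValue L v μ (finGammaTwo L v a) * (finHeckeValue L v μ (-((finGammaTwo L v a - e) ^ 2) * (e ^ 2)⁻¹))⁻¹ := by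
  unfold finTau
  rw [finTauArg_of_fst_eq_smul_one L v a h]

include h in
/-- **`(G,H)`-REGULARITY OF THE SCALAR PARTNER: `χ_g(u)` is a unit iff `u − e` is** (`e_w ≠ u_w` at every `w ∣ v`). [cite: Rogawski1990, Prop. 8.2.1 (a) p. 118; §4.9 p. 55] -/
theorem isUnit_eval_finCharpolyTwo_iff_of_fst_eq_smul_one :
    IsUnit ((finCharpolyTwo L v a).eval (finGammaTwo L v a)) ↔ IsUnit (finGammaTwo L v a - e) := by
  rw [eval_finCharpolyTwo_of_fst_eq_smul_one L v a h]
  exact isUnit_pow_iff two_ne_zero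

include h in
/-- **`D_{G∕H,v}(γ_H) = Π_{w∣v} ‖(u − e)_w‖_w`** at the scalar partner, every finite `v` (`(Π‖(u−e)²_w‖)^{1∕2} = Π‖(u−e)_w‖`). [cite: Rogawski1990, §4.9 p. 55; Prop. 8.2.1 (a) p. 118] -/
theorem finWeylRatio_of_fst_eq_smul_one :
    finWeylRatio L v a = ∏ w : UnitaryGroup.PlacesOver L v, ‖(finGammaTwo L v a - e) w‖ := by
  unfold finWeylRatio
  rw [eval_finCharpolyTwo_of_fst_eq_smul_one L v a h]
  have hsq : (∏ w : UnitaryGroup.PlacesOver L v, ‖((finGammaTwo L v a - e) ^ 2) w‖) =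
      (∏ w : UnitaryGroup.PlacesOver L v, ‖(finGammaTwo L v a - e) w‖) ^ 2 := by
    rw [← Finset.prod_pow]
    exact Finset.prod_congr rfl fun w _ => by rw [Pi.pow_apply, norm_pow]
  rw [hsq, Real.sqrt_sq (Finset.prod_nonneg fun w _ => norm_nonneg _)]

end Local

/-! ## §2 Split `v`: `D_{G∕H,v} = ‖(u − e)_w‖² ∕ (‖e_w‖·‖u_w‖)` -/

section Split

variable (L : Type) [Field L] [NumberField L] [IsCMField L] (v : HeightOneSpectrum (𝓞 ↥(maximalRealSubfield L)))
  (a : (UnitaryGroup.cmDatum L 2 (Matrix.of fun i j : Fin 2 => if i.val + j.val + 1 = 2 then (1 : L) else 0)).Local v ×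
      (UnitaryGroup.cmDatum L 1 (Matrix.of fun i j : Fin 1 => if i.val + j.val + 1 = 1 then (1 : L) else 0)).Local v)
  {e : UnitaryGroup.LocalRing L v} (h : (a.1.val.val : Matrix (Fin 2) (Fin 2) (UnitaryGroup.LocalRing L v)) = e • (1 : Matrix (Fin 2) (Fin 2) _))
  (w : UnitaryGroup.PlacesOver L v)

include h in
/-- **`‖(u − e)_{w̄}‖_{w̄} = ‖(u − e)_w‖_w ∕ (‖e_w‖_w · ‖u_w‖_w)`** at the scalar partner (★ D-S2 `norm_eval_finCharpolyTwo_galInv` with `χ_g(u) = (u−e)²`, `det g_w = e_w²`,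
square roots taken). [cite: Rogawski1990, Lemma 4.13.1 p. 70; §4.9 p. 55] -/
theorem norm_sub_galInv_of_fst_eq_smul_one :
    ‖(finGammaTwo L v a - e) (UnitaryGroup.PlacesOver.galInv (IsCMField.complexConj L) w)‖ =
      ‖(finGammaTwo L v a - e) w‖ * ‖e w‖⁻¹ * ‖finGammaTwo L v a w‖⁻¹ := by
  have hN := norm_eval_finCharpolyTwo_galInv L v a w
  rw [eval_finCharpolyTwo_of_fst_eq_smul_one L v a h] at hN
  have hdet : ((a.1.val.val : Matrix (Fin 2) (Fin 2) (UnitaryGroup.LocalRing L v)).map (fun x => x w)).det = e w ^ 2 := by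
    rw [h]
    have hm : (e • (1 : Matrix (Fin 2) (Fin 2) (UnitaryGroup.LocalRing L v))).map (fun x => x w) = e w • (1 : Matrix (Fin 2) (Fin 2) _) := by
      ext i j
      simp only [Matrix.map_apply, Matrix.smul_apply, smul_eq_mul, Pi.mul_apply]
      by_cases hij : i = j
      · subst hij; simp
      · simp [Matrix.one_apply_ne hij]
    rw [hm, Matrix.det_smul, Matrix.det_one, mul_one, Fintype.card_fin]
  rw [hdet, Pi.pow_apply, Pi.pow_apply, norm_pow, norm_pow, norm_pow] at hN
  -- `hN : ‖(u−e)_{w̄}‖² = ‖(u−e)_w‖² · (‖e_w‖²)⁻¹ · (‖u_w‖²)⁻¹`; take square roots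
  have hx : 0 ≤ ‖(finGammaTwo L v a - e) (UnitaryGroup.PlacesOver.galInv (IsCMField.complexConj L) w)‖ := norm_nonneg _
  have hy : 0 ≤ ‖(finGammaTwo L v a - e) w‖ * ‖e w‖⁻¹ * ‖finGammaTwo L v a w‖⁻¹ := by positivity
  have hsq : ‖(finGammaTwo L v a - e) (UnitaryGroup.PlacesOver.galInv (IsCMField.complexConj L) w)‖ ^ 2 =
      (‖(finGammaTwo L v a - e) w‖ * ‖e w‖⁻¹ * ‖finGammaTwo L v a w‖⁻¹) ^ 2 := by
    rw [hN, mul_pow, mul_pow, inv_pow, inv_pow]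
  exact (sq_eq_sq₀ hx hy).1 hsq

include h in
/-- **`D_{G∕H,v}(γ_H) = ‖(u − e)_w‖_w² ∕ (‖e_w‖_w · ‖u_w‖_w)` AT A SPLIT PLACE** for the scalar partner `γ_H = (e·1₂, u)` — print's `|D_{G∕H}(γ₀)|` at
`γ₀ = diag(e, e, u)` (F0P3a-p04: `‖e₁ − e₂‖²∕‖e₁e₂‖`). [cite: Rogawski1990, Prop. 8.2.1 (a) p. 118; Lemma 4.13.1 p. 70; §4.9 p. 55] -/
theorem finWeylRatio_of_fst_eq_smul_one_of_split (hw : IsCMField.complexConj L • w.1 ≠ w.1) :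
    finWeylRatio L v a = ‖(finGammaTwo L v a - e) w‖ ^ 2 * ‖e w‖⁻¹ * ‖finGammaTwo L v a w‖⁻¹ := by
  classical
  have hne := UnitaryGroup.PlacesOver.galInv_ne (IsCMField.complexConj L) w hw
  rw [finWeylRatio_of_fst_eq_smul_one L v a h, univ_eq_pair_of_split L v w, Finset.prod_pair hne.symm,
    norm_sub_galInv_of_fst_eq_smul_one L v a h w]
  ring

variable (H' : Matrix (Fin 3) (Fin 3) L)

include h in
open scoped Classical in
/-- **`Δ‴_v(γ_H, γ′) = μ_v(u)·μ_v(−(u−e)²e⁻²)⁻¹ · ‖(u−e)_w‖²∕(‖e_w‖‖u_w‖)` at a split place**, for the scalar partner and every matching `γ′` with `u − e` a unit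
(`κ_v = +1`, ★ `finExplicitDelta_eq_tau_mul_weyl_of_split`). [cite: Rogawski1990, §14.6 p. 242; §4.9 p. 55; Prop. 8.2.1 (a) p. 118] -/
theorem finExplicitDelta_of_fst_eq_smul_one_of_split (hw : IsCMField.complexConj L • w.1 ≠ w.1) (μ : HeckeCharacter L)
    {b : (UnitaryGroup.cmDatum L 3 H').Local v} (hb : IsLocalNormPair L H' v a b) (hu : IsUnit (finGammaTwo L v a - e)) :
    finExplicitDelta L v H' a μ b =
      finHeckeValue L v μ (finGammaTwo L v a) * (finHeckeValue L v μ (-((finGammaTwo L v a - e) ^ 2) * (e ^ 2)⁻¹))⁻¹ *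
        ((‖(finGammaTwo L v a - e) w‖ ^ 2 * ‖e w‖⁻¹ * ‖finGammaTwo L v a w‖⁻¹ : ℝ) : ℂ) := by
  rw [finExplicitDelta_eq_tau_mul_weyl_of_split L v a w H' hw μ hb ((isUnit_eval_finCharpolyTwo_iff_of_fst_eq_smul_one L v a h).2 hu),
    finTau_of_fst_eq_smul_one L v a h μ, finWeylRatio_of_fst_eq_smul_one_of_split L v a h w hw]

end Split

/-! ## §3 The rational singular partner `γ_H = (e₁·1₂, e₂) ∈ H(L⁺)` -/

section Rational

variable (L : Type) [Field L] [NumberField L] [IsCMField L]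
  (γH : (UnitaryGroup.cmDatum L 2 (Matrix.of fun i j : Fin 2 => if i.val + j.val + 1 = 2 then (1 : L) else 0)).Rational ×
    (UnitaryGroup.cmDatum L 1 (Matrix.of fun i j : Fin 1 => if i.val + j.val + 1 = 1 then (1 : L) else 0)).Rational)
  {e₁ : L} (h : (γH.1.val.val : Matrix (Fin 2) (Fin 2) L) = e₁ • (1 : Matrix (Fin 2) (Fin 2) L))

include h in
/-- **`χ_g(u) = (e₂ − e₁)²` in `L`** for the rational scalar partner `γ_H = (e₁·1₂, e₂)`: the `(G,H)`-regularity guard `χ_g(u) ≠ 0` of the rational-pair lemmas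
(★ (P-α)…(P-γ), ★ F4, ★ G2) is `e₁ ≠ e₂`. [cite: Rogawski1990, Prop. 8.2.1 (a) p. 118; §4.9 p. 55] -/
theorem eval_charpoly_of_fst_eq_smul_one_rational :
    ((γH.1.val.val : Matrix (Fin 2) (Fin 2) L).charpoly).eval ((γH.2.val.val : Matrix (Fin 1) (Fin 1) L) 0 0) =
      ((γH.2.val.val : Matrix (Fin 1) (Fin 1) L) 0 0 - e₁) ^ 2 := by
  rw [h, Matrix.charpoly_fin_two]
  simp only [Matrix.trace_fin_two, Matrix.det_fin_two, Matrix.smul_apply, Matrix.one_apply_eq,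
    Matrix.one_apply_ne (by decide : (0 : Fin 2) ≠ 1), Matrix.one_apply_ne (by decide : (1 : Fin 2) ≠ 0), smul_eq_mul, mul_one, mul_zero, sub_zero,
    map_add, map_mul, eval_add, eval_sub, eval_mul, eval_pow, eval_X, eval_C]
  ring

include h in
/-- `χ_g(u) ≠ 0 ↔ e₂ ≠ e₁` for the rational scalar partner. [cite: Rogawski1990, Prop. 8.2.1 (a) p. 118] -/
theorem eval_charpoly_ne_zero_iff_of_fst_eq_smul_one_rational :
    ((γH.1.val.val : Matrix (Fin 2) (Fin 2) L).charpoly).eval ((γH.2.val.val : Matrix (Fin 1) (Fin 1) L) 0 0) ≠ 0 ↔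
      ((γH.2.val.val : Matrix (Fin 1) (Fin 1) L) 0 0) ≠ e₁ := by
  rw [eval_charpoly_of_fst_eq_smul_one_rational L γH h, pow_ne_zero_iff two_ne_zero, sub_ne_zero]

include h in
open scoped Classical in
/-- **`D_{G∕H,∞}(γ_H ⊗ 1) = Π_{w complex} ‖σ_w(e₂ − e₁)‖²`** for the rational scalar partner (★ `archWeylRatio_rationalArch`). [cite: Rogawski1990, §4.9 p. 55; Prop. 8.2.1 (a) p. 118] -/
theorem archWeylRatio_rationalArch_of_fst_eq_smul_one :
    archWeylRatio L (rationalArch L γH) =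
      ∏ w : {w : InfinitePlace L // InfinitePlace.IsComplex w}, ‖w.1.embedding (((γH.2.val.val : Matrix (Fin 1) (Fin 1) L) 0 0) - e₁)‖ ^ 2 := by
  rw [archWeylRatio_rationalArch, eval_charpoly_of_fst_eq_smul_one_rational L γH h]
  exact Finset.prod_congr rfl fun w _ => by rw [map_pow, norm_pow]

end Rational


/-! ## §4 (ED. 2) The projector and the sign at the scalar partner -/

section Projector

variable (L : Type) [Field L] [NumberField L] [IsCMField L] (v : HeightOneSpectrum (𝓞 ↥(maximalRealSubfield L)))
  (H' : Matrix (Fin 3) (Fin 3) L)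
  (a : (UnitaryGroup.cmDatum L 2 (Matrix.of fun i j : Fin 2 => if i.val + j.val + 1 = 2 then (1 : L) else 0)).Local v ×
      (UnitaryGroup.cmDatum L 1 (Matrix.of fun i j : Fin 1 => if i.val + j.val + 1 = 1 then (1 : L) else 0)).Local v)
  {e : UnitaryGroup.LocalRing L v} (h : (a.1.val.val : Matrix (Fin 2) (Fin 2) (UnitaryGroup.LocalRing L v)) = e • (1 : Matrix (Fin 2) (Fin 2) _))
  (γ' : (UnitaryGroup.cmDatum L 3 H').Local v)

include h in
/-- **`P_v((e·1₂, u), γ′) = (γ′ − e·1₃)²`** — `χ_{e·1₂}(γ′) = γ′² − 2e·γ′ + e²` (★ `finEigenlineProjector`). [cite: Rogawski1990, §4.9 p. 55; §3.5 Prop. 3.5.2 (c) p. 29] -/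
theorem finEigenlineProjector_of_fst_eq_smul_one :
    finEigenlineProjector L v H' a γ' = ((γ'.val.val : Matrix (Fin 3) (Fin 3) (UnitaryGroup.LocalRing L v)) - e • (1 : Matrix (Fin 3) (Fin 3) (UnitaryGroup.LocalRing L v))) ^ 2 := by
  change (γ'.val.val : Matrix (Fin 3) (Fin 3) (UnitaryGroup.LocalRing L v)) * (γ'.val.val : Matrix (Fin 3) (Fin 3) (UnitaryGroup.LocalRing L v)) - (a.1.val.val : Matrix (Fin 2) (Fin 2) (UnitaryGroup.LocalRing L v)).trace • (γ'.val.val : Matrix (Fin 3) (Fin 3) (UnitaryGroup.LocalRing L v)) +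
      (a.1.val.val : Matrix (Fin 2) (Fin 2) (UnitaryGroup.LocalRing L v)).det • (1 : Matrix (Fin 3) (Fin 3) (UnitaryGroup.LocalRing L v)) = _
  rw [h, Matrix.trace_smul, Matrix.trace_one, Matrix.det_smul, Matrix.det_one, mul_one, Fintype.card_fin]
  have hR : ((γ'.val.val : Matrix (Fin 3) (Fin 3) (UnitaryGroup.LocalRing L v)) - e • (1 : Matrix (Fin 3) (Fin 3) (UnitaryGroup.LocalRing L v))) ^ 2 =
      (γ'.val.val : Matrix (Fin 3) (Fin 3) (UnitaryGroup.LocalRing L v)) * (γ'.val.val : Matrix (Fin 3) (Fin 3) (UnitaryGroup.LocalRing L v)) - e • (γ'.val.val : Matrix (Fin 3) (Fin 3) (UnitaryGroup.LocalRing L v)) - e • (γ'.val.val : Matrix (Fin 3) (Fin 3) (UnitaryGroup.LocalRing L v)) + (e * e) • (1 : Matrix (Fin 3) (Fin 3) (UnitaryGroup.LocalRing L v)) := by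
    simp only [sq, sub_mul, mul_sub, Matrix.smul_mul, Matrix.mul_smul, Matrix.one_mul, Matrix.mul_one, smul_smul]
    abel
  rw [hR]
  simp only [smul_eq_mul, Nat.cast_ofNat]
  module

include h in
/-- `x_j = Σ_{i,k} σ((γ′ − e)²_{ij}) (H′_v)_{ik} (γ′ − e)²_{kj}` at the scalar partner (★ `finColumnFormValue`). [cite: Rogawski1990, §3.5 Prop. 3.5.2 (c) p. 29] -/
theorem finColumnFormValue_of_fst_eq_smul_one (j : Fin 3) :
    finColumnFormValue L v H' a γ' j =
      ∑ i : Fin 3, ∑ k : Fin 3,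
        UnitaryGroup.conjLocal L (IsCMField.complexConj L) v ((((γ'.val.val : Matrix (Fin 3) (Fin 3) (UnitaryGroup.LocalRing L v)) - e • (1 : Matrix (Fin 3) (Fin 3) (UnitaryGroup.LocalRing L v))) ^ 2 : Matrix (Fin 3) (Fin 3) (UnitaryGroup.LocalRing L v)) i j) *
          ((UnitaryGroup.adelicForm L 3 H').map (UnitaryGroup.adeleToLocal L v)) i k *
          (((γ'.val.val : Matrix (Fin 3) (Fin 3) (UnitaryGroup.LocalRing L v)) - e • (1 : Matrix (Fin 3) (Fin 3) (UnitaryGroup.LocalRing L v))) ^ 2 : Matrix (Fin 3) (Fin 3) (UnitaryGroup.LocalRing L v)) k j := by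
  unfold finColumnFormValue
  rw [finEigenlineProjector_of_fst_eq_smul_one L v H' a h γ']

include h in
open scoped Classical in
/-- **`κ_v` AT THE SCALAR PARTNER, NON-SPLIT `v`, READS ON ANY NON-ZERO COLUMN OF `(γ′ − e)²`**: for a matching `γ′` with `u − e` a unit and a column `j` with
`((γ′ − e)²)·e_j ≠ 0`, `κ_v((e·1₂,u), γ′) = +1` if `x_j = z σ(z)` for a unit `z`, `−1` otherwise (★ F2A `finKappaAt_eq_ite_finColumnFormValue`) — the sign of the
(κ-loc) non-split letter at print's singular partner, in terms of `γ′` alone. [cite: Rogawski1990, §14.6 p. 242; §4.3 p. 43; §3.5 Prop. 3.5.2 (c) p. 29] -/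
theorem finKappaAt_of_fst_eq_smul_one_eq_ite (hv : Subsingleton (UnitaryGroup.PlacesOver L v)) (hb : IsLocalNormPair L H' v a γ')
    (hu : IsUnit (finGammaTwo L v a - e)) {j : Fin 3}
    (hj : (fun i => (((γ'.val.val : Matrix (Fin 3) (Fin 3) (UnitaryGroup.LocalRing L v)) - e • (1 : Matrix (Fin 3) (Fin 3) (UnitaryGroup.LocalRing L v))) ^ 2 : Matrix (Fin 3) (Fin 3) (UnitaryGroup.LocalRing L v)) i j) ≠ 0) :
    finKappaAt L v H' a γ' =
      if ∃ z : UnitaryGroup.LocalRing L v, IsUnit z ∧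
          finColumnFormValue L v H' a γ' j = z * UnitaryGroup.conjLocal L (IsCMField.complexConj L) v z
      then 1 else -1 := by
  have hj' : (fun i => finEigenlineProjector L v H' a γ' i j) ≠ 0 := by
    rw [finEigenlineProjector_of_fst_eq_smul_one L v H' a h γ']
    exact hj
  exact finKappaAt_eq_ite_finColumnFormValue L v H' a γ' hv hb ((isUnit_eval_finCharpolyTwo_iff_of_fst_eq_smul_one L v a h).2 hu) hj'

end Projector

end Literature.NumberTheory.Rogawski1990

end
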